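import Literature.Probability.Percolation.SlabRSWTheorem314Case3
import Literature.Probability.Percolation.SlabRSWGluingRect
import Literature.Probability.Percolation.SlabGluingRouting
import HarnessLib

/-!
# Newman–Tassion–Wu 2017, Theorem 3.14, Case 3 — the separation step: the path from `Y` meets `γ'`

Topic: `Literature/Probability/Percolation`. NTW (arXiv:1512.09107, p. 16): "the set `\overline{γ ∪ γ'}`
disconnects the top side `𝖳(R)` of `R` from its bottom side `𝖡(R)`, in the sense that any path from
top to bottom in `R` must intersect `\overline{γ ∪ γ'}`"; in Case 3 (p. 17) the open path from `Y` to
`𝖡(R)` lies in `R ∖ 𝒞 ⊆ R ∖ 𝒩(Γ̄, 3r)`, so it cannot meet `Γ̄` and therefore meets the reflection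
`Γ̄'` — this is how the event `𝒞_γ` ("an open path … from `Y` to `\overline{γ'}`") arises in (3.49).

In the reflected frame of `SlabRSWTheorem314Case2/3.lean` (`Q = (case2Setup n).Q`:
`R' = [0,14n]×[0,13n-1]`, `Γ` from `A = {0}×[0,4n-1]` to the column `{x = 7n}` inside
`S' = [0,7n]×[0,8n-1]`, `C = {0}×[5n,13n-1]`, mirror `τ : x ↦ 14n - x`) this file proves:

* `colWalk` and its planar-walk lemmas; `isPlanarWalk_append`;
* **`evOff_subset_toMirror`** — for a lattice configuration `ω` with `A ⟷^{S'} B` (so `Γ = Q.γ ω`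
  exists) and any set `K ⊇ {v ∈ R̄' : planar v within ρ₂ of Γ̄}` (e.g. `K = 𝒞(ω)`), every lattice
  configuration of `C ⟷^{R' ∖ K} 𝖡` (`Q.evOff`) has an open path inside
  `R' ∖ 𝒩(Γ, ρ₂)` from `C̄` to the columns of `τΓ`: the planar-crossing fact `planarCrossing_rect'`
  in the enlarged rectangle `[-1,14n+1]×[-1,13n-1]` applied to the walk
  `stub ∪ Γ ∪ τΓ ∪ stub` (left to right) and `column {-1} ∪ path ∪ stub` (top to bottom);
* `real_evOff_explored_le_toMirror` — hence `P[C ⟷^{R' ∖ 𝒞(ω)} 𝖡] ≤ P[C ⟷^{R' ∖ 𝒩(Γ,ρ₂)} τΓ]`.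

## Sources

* C. M. Newman, V. Tassion, W. Wu, *Critical percolation and the minimal spanning tree in slabs*,
  Comm. Pure Appl. Math. 70 (2017), arXiv:1512.09107: §3.5, the paragraph before Lemma 3.16 and
  the proof of Theorem 3.14, Case 3, first observation and (3.49) [NewmanTassionWu2017].
-/

noncomputable section

namespace Literature.Probability.Percolation

open MeasureTheory LatticeModels SimpleGraph

namespace NTW17

variable {k : ℕ}

/-! ## Planar walks: columns and concatenation -/

/-- The column `{x} × [y₀, y₀ + m]` listed downwards, from `(x, y₀ + m)` to `(x, y₀)`.
[cite: NewmanTassionWu2017, §3.5 (the sides of R)] -/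
def colWalk (x y₀ : ℤ) : ℕ → List (ℤ × ℤ)
  | 0 => [(x, y₀)]
  | m + 1 => (x, y₀ + (m + 1 : ℕ)) :: colWalk x y₀ m

/-- `colWalk` is non-empty. [cite: NewmanTassionWu2017, §3.5 (the sides of R)] -/
theorem colWalk_ne_nil (x y₀ : ℤ) (m : ℕ) : colWalk x y₀ m ≠ [] := by
  cases m <;> simp [colWalk]

/-- The first cell of `colWalk`. [cite: NewmanTassionWu2017, §3.5 (the sides of R)] -/
theorem head_colWalk (x y₀ : ℤ) (m : ℕ) : (colWalk x y₀ m).head (colWalk_ne_nil x y₀ m) = (x, y₀ + m) := by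
  cases m <;> simp [colWalk]

/-- The last cell of `colWalk`. [cite: NewmanTassionWu2017, §3.5 (the sides of R)] -/
theorem getLast_colWalk (x y₀ : ℤ) : ∀ m : ℕ, (colWalk x y₀ m).getLast (colWalk_ne_nil x y₀ m) = (x, y₀) := by
  intro m
  induction m with
  | zero => simp [colWalk]
  | succ m ih =>
    simp only [colWalk]
    rw [List.getLast_cons (colWalk_ne_nil x y₀ m)]
    exact ih

/-- The first cell of `colWalk`, optional form. [cite: NewmanTassionWu2017, §3.5 (the sides of R)] -/
theorem head?_colWalk (x y₀ : ℤ) (m : ℕ) : (colWalk x y₀ m).head? = some (x, y₀ + m) := by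
  rw [List.head?_eq_some_head (colWalk_ne_nil x y₀ m), head_colWalk]

/-- The last cell of `colWalk`, optional form. [cite: NewmanTassionWu2017, §3.5 (the sides of R)] -/
theorem getLast?_colWalk (x y₀ : ℤ) (m : ℕ) : (colWalk x y₀ m).getLast? = some (x, y₀) := by
  rw [List.getLast?_eq_some_getLast (colWalk_ne_nil x y₀ m), getLast_colWalk]

/-- The cells of `colWalk`. [cite: NewmanTassionWu2017, §3.5 (the sides of R)] -/
theorem mem_colWalk_iff (x y₀ : ℤ) : ∀ (m : ℕ) (z : ℤ × ℤ),
    z ∈ colWalk x y₀ m ↔ z.1 = x ∧ y₀ ≤ z.2 ∧ z.2 ≤ y₀ + m := by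
  intro m
  induction m with
  | zero =>
    intro z
    simp only [colWalk, List.mem_singleton, Nat.cast_zero, add_zero]
    constructor
    · rintro rfl; simp
    · rintro ⟨h1, h2, h3⟩; ext <;> simp <;> omega
  | succ m ih =>
    intro z
    simp only [colWalk, List.mem_cons, ih]
    constructor
    · rintro (rfl | ⟨h1, h2, h3⟩)
      · refine ⟨rfl, ?_, ?_⟩
        · show y₀ ≤ y₀ + ((m + 1 : ℕ) : ℤ); omega
        · exact le_rfl
      · exact ⟨h1, h2, by push_cast; omega⟩
    · rintro ⟨h1, h2, h3⟩
      by_cases hz : z.2 = y₀ + (m + 1 : ℕ)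
      · left; ext <;> simp [h1, hz]
      · right; exact ⟨h1, h2, by push_cast at hz ⊢; omega⟩

/-- `colWalk` is a planar walk. [cite: NewmanTassionWu2017, §3.5 (the sides of R)] -/
theorem isPlanarWalk_colWalk (x y₀ : ℤ) : ∀ m : ℕ, IsPlanarWalk (colWalk x y₀ m) := by
  intro m
  induction m with
  | zero => exact List.IsChain.singleton _
  | succ m ih =>
    simp only [colWalk]
    rw [IsPlanarWalk] at ih ⊢
    refine List.IsChain.cons_of_ne_nil (colWalk_ne_nil x y₀ m) ih ?_
    rw [head_colWalk]
    right; right; right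
    ext <;> simp [add_assoc]

/-- Concatenation of planar walks whose junction cells are equal or adjacent.
[cite: NewmanTassionWu2017, §3.2 (Theorem 3.6, "the projection on ℤ² of any path")] -/
theorem isPlanarWalk_append {l₁ l₂ : List (ℤ × ℤ)} (h₁ : IsPlanarWalk l₁) (h₂ : IsPlanarWalk l₂)
    (hj : ∀ x ∈ l₁.getLast?, ∀ y ∈ l₂.head?, x = y ∨ planarAdj x y) : IsPlanarWalk (l₁ ++ l₂) :=
  List.isChain_append.2 ⟨h₁, h₂, hj⟩

/-- The reverse of a planar walk is a planar walk. [cite: NewmanTassionWu2017, §3.2 (Theorem 3.6)] -/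
theorem isPlanarWalk_reverse {l : List (ℤ × ℤ)} (h : IsPlanarWalk l) : IsPlanarWalk l.reverse := by
  rw [IsPlanarWalk, List.isChain_reverse]
  refine h.imp fun x y hxy => ?_
  rcases hxy with hxy | hxy
  · exact Or.inl hxy.symm
  · exact Or.inr (planarAdj_symm hxy)

/-! ## The separation step -/

section Sep

variable {n ρ₂ : ℕ} (hn : 1 ≤ n) {ω ω' : BondConfig (slab 3 k)}

/-- **The open path from `Y` to `𝖡(R)` meets `γ'`** (reflected frame). Let `ω` be a lattice
configuration with `A ⟷^{S'} B`, `Γ = Q.γ ω`, and `K ⊇ {v ∈ R̄' : dist*(planar v, Γ̄) ≤ ρ₂}`. Then every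
lattice configuration `ω'` with an open path from `C̄` to the bottom row inside `R̄' ∖ K` has an open
path inside `R' ∖ 𝒩(Γ, ρ₂)` (lifted) from `C̄` to a vertex over a column of `τΓ`, `τ : x ↦ 14n - x`.
[cite: NewmanTassionWu2017, §3.5 (before Lemma 3.16: "γ ∪ γ′ disconnects 𝖳(R) from 𝖡(R)"; proof of Theorem 3.14, Case 3, first observation)] -/
theorem evOff_subset_toMirror (hω : ω ⊆ (slabGraph 3 k).edgeSet) (hA : ω ∈ (case2Setup n hn).Q.evAB k)
    {K : Set (slab 3 k)}
    (hK : ∀ v ∈ slabLift k (case2Setup n hn).R, Near k ((case2Setup n hn).Q.γ k ω) ρ₂ (planar k v) → v ∈ K)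
    (hω' : ω' ⊆ (slabGraph 3 k).edgeSet) (h : ω' ∈ (case2Setup n hn).Q.evOff k {z | z.2 = 0} K) :
    ω' ∈ slabConn k ((case2Setup n hn).R \ {z | Near k ((case2Setup n hn).Q.γ k ω) ρ₂ z}) (case2Setup n hn).C
      {z | ∃ g ∈ (case2Setup n hn).Q.γ k ω, z = planarReflect (14 * (n : ℤ)) (planar k g)} := by
  set E := case2Setup n hn with hE
  set Γ := E.Q.γ k ω with hΓdef
  set τ := planarReflect (14 * (n : ℤ)) with hτ
  obtain ⟨hΓO, -⟩ := E.Q.γ_spec hA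
  -- the path `π` from `c ∈ C̄` to `z` on the bottom row inside `R̄ ∖ K`
  obtain ⟨c, hc, z, hz, hcz⟩ := h
  obtain ⟨π, hπ⟩ := exists_isOSAP_of_openConnIn hcz
  have hπR : ∀ u ∈ π, planar k u ∈ E.R ∧ ¬Near k Γ ρ₂ (planar k u) := by
    intro u hu
    have h1 := hπ.subset u hu
    exact ⟨h1.1, fun hnear => h1.2 (hK u h1.1 hnear)⟩
  have hπhead : π.head hπ.ne_nil = c := hπ.head_mem hπ.ne_nil
  have hπlast : π.getLast hπ.ne_nil = z := hπ.last_mem hπ.ne_nil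
  -- coordinates
  have hcC : planar k c ∈ E.C := hc
  rw [show E.C = sideSeg 0 (5 * n) (13 * n - 1) from rfl, sideSeg, Set.mem_setOf_eq] at hcC
  have hz0 : (planar k z).2 = 0 := hz
  have hzR : planar k z ∈ E.R := (hπR z (by rw [← hπlast]; exact List.getLast_mem _)).1
  rw [show E.R = boxR 0 (14 * n) 0 (13 * n - 1) from rfl, mem_boxR_iff] at hzR
  -- `Γ` in coordinates
  have hΓS : ∀ g ∈ Γ, planar k g ∈ E.S := fun g hg => hΓO.subset g hg
  have haA : planar k (Γ.head hΓO.ne_nil) ∈ E.A := hΓO.head_mem hΓO.ne_nil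
  have hbB : planar k (Γ.getLast hΓO.ne_nil) ∈ E.B := hΓO.last_mem hΓO.ne_nil
  rw [show E.A = sideSeg 0 0 (4 * n - 1) from rfl, sideSeg, Set.mem_setOf_eq] at haA
  rw [ExtSetup.mem_B_iff] at hbB
  have hb7 : (planar k (Γ.getLast hΓO.ne_nil)).1 = 7 * n := by rw [hbB.2]; rfl
  set a₂ : ℤ := (planar k (Γ.head hΓO.ne_nil)).2 with ha₂
  have hpa : planar k (Γ.head hΓO.ne_nil) = (0, a₂) := Prod.ext haA.1 rfl
  -- the two planar walks
  set pγ : List (ℤ × ℤ) := Γ.map (planar k) with hpγ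
  set pπ : List (ℤ × ℤ) := π.map (planar k) with hpπ
  have hpγne : pγ ≠ [] := by simpa [hpγ] using hΓO.ne_nil
  have hpπne : pπ ≠ [] := by simpa [hpπ] using hπ.ne_nil
  have hwγ : IsPlanarWalk pγ := isPlanarWalk_map_planar hω hΓO.chain
  have hwπ : IsPlanarWalk pπ := isPlanarWalk_map_planar hω' hπ.chain
  have hpγhead : pγ.head hpγne = planar k (Γ.head hΓO.ne_nil) := by simp [hpγ, List.head_map]
  have hpγlast : pγ.getLast hpγne = planar k (Γ.getLast hΓO.ne_nil) := by simp [hpγ, List.getLast_map]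
  have hpπhead : pπ.head hpπne = planar k c := by simp [hpπ, List.head_map, hπhead]
  have hpπlast : pπ.getLast hpπne = planar k z := by simp [hpπ, List.getLast_map, hπlast]
  have hmemγ : ∀ v ∈ pγ, 0 ≤ v.1 ∧ v.1 ≤ 7 * n ∧ 0 ≤ v.2 := by
    intro v hv
    obtain ⟨g, hg, rfl⟩ := List.mem_map.1 hv
    have := hΓS g hg
    rw [show E.S = boxR 0 (7 * n) 0 (8 * n - 1) from rfl, mem_boxR_iff] at this
    omega
  have hmemπ : ∀ v ∈ pπ, 0 ≤ v.1 ∧ v.1 ≤ 14 * n ∧ 0 ≤ v.2 ∧ v.2 ≤ 13 * n - 1 := by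
    intro v hv
    obtain ⟨u, hu, rfl⟩ := List.mem_map.1 hv
    have := (hπR u hu).1
    rw [show E.R = boxR 0 (14 * n) 0 (13 * n - 1) from rfl, mem_boxR_iff] at this
    omega
  -- LR walk: `(-1, a₂) :: pγ ++ (pγ.map τ).reverse ++ [(14n+1, a₂)]`
  set LR : List (ℤ × ℤ) := (-1, a₂) :: (pγ ++ ((pγ.map τ).reverse ++ [(14 * (n : ℤ) + 1, a₂)])) with hLR
  have hLRne : LR ≠ [] := List.cons_ne_nil _ _
  have hwLR : IsPlanarWalk LR := by
    rw [hLR]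
    have h2 : IsPlanarWalk ((pγ.map τ).reverse ++ [(14 * (n : ℤ) + 1, a₂)]) := by
      refine isPlanarWalk_append (isPlanarWalk_reverse (hwγ.map (planarAdj_planarReflect _)))
        (List.IsChain.singleton _) fun x hx y hy => ?_
      rw [List.getLast?_reverse, List.head?_map, List.head?_eq_some_head hpγne, Option.map_some,
        Option.mem_def, Option.some.injEq] at hx
      rw [List.head?_cons, Option.mem_def, Option.some.injEq] at hy
      subst hx; subst hy
      right
      rw [hpγhead, hτ, planarReflect_apply, haA.1]
      left; left
      ext <;> simp [ha₂]
    have h1 : IsPlanarWalk (pγ ++ ((pγ.map τ).reverse ++ [(14 * (n : ℤ) + 1, a₂)])) := by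
      refine isPlanarWalk_append hwγ h2 fun x hx y hy => ?_
      rw [List.getLast?_eq_some_getLast hpγne, Option.mem_def, Option.some.injEq] at hx
      have hy' : y = τ (pγ.getLast hpγne) := by
        rw [List.head?_append, List.head?_reverse, List.getLast?_map, List.getLast?_eq_some_getLast hpγne,
          Option.map_some, Option.some_or, Option.mem_def, Option.some.injEq] at hy
        exact hy.symm
      subst hx
      rw [hy', hpγlast, hτ, planarReflect_apply]
      left
      ext <;> simp [hb7]; omega
    refine List.IsChain.cons_of_ne_nil (by simp [hpγne]) h1 ?_
    rw [List.head_append_of_ne_nil hpγne, hpγhead, hpa]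
    right; left; left
    ext <;> simp
  -- TB walk: `colWalk (-1) c₂ m ++ pπ ++ [(z₁, -1)]`
  set c₂ : ℤ := (planar k c).2 with hc₂
  set m : ℕ := (13 * (n : ℤ) - 1 - c₂).toNat with hm
  have hmc : c₂ + m = 13 * n - 1 := by rw [hm, Int.toNat_of_nonneg (by omega)]; ring
  set TB : List (ℤ × ℤ) := colWalk (-1) c₂ m ++ (pπ ++ [((planar k z).1, -1)]) with hTB
  have hTBne : TB ≠ [] := by simp [hTB, colWalk_ne_nil]
  have hwTB : IsPlanarWalk TB := by
    rw [hTB]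
    have h2 : IsPlanarWalk (pπ ++ [((planar k z).1, -1)]) := by
      refine isPlanarWalk_append hwπ (List.IsChain.singleton _) fun x hx y hy => ?_
      rw [List.getLast?_eq_some_getLast hpπne, Option.mem_def, Option.some.injEq] at hx
      rw [List.head?_cons, Option.mem_def, Option.some.injEq] at hy
      subst hx; subst hy
      rw [hpπlast]
      right; right; right
      ext <;> simp [hz0]
    refine isPlanarWalk_append (isPlanarWalk_colWalk _ _ _) h2 fun x hx y hy => ?_
    rw [getLast?_colWalk, Option.mem_def, Option.some.injEq] at hx
    rw [List.head?_append, List.head?_eq_some_head hpπne, Option.some_or, Option.mem_def, Option.some.injEq, hpπhead] at hy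
    subst hx; subst hy
    right; left; left
    ext <;> simp [hcC.1, hc₂]
  -- inside the enlarged rectangle
  have hLRbox : ∀ v ∈ LR, v ∈ boxR (-1) (14 * n + 1) (-1) (13 * n - 1) := by
    intro v hv
    rw [mem_boxR_iff]
    rw [hLR, List.mem_cons, List.mem_append, List.mem_append, List.mem_reverse, List.mem_singleton] at hv
    rcases hv with rfl | hv | hv | rfl
    · simp only; omega
    · obtain ⟨g, hg, rfl⟩ := List.mem_map.1 hv
      have h8 := hΓS g hg
      rw [show E.S = boxR 0 (7 * n) 0 (8 * n - 1) from rfl, mem_boxR_iff] at h8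
      omega
    · obtain ⟨u, hu, rfl⟩ := List.mem_map.1 hv
      obtain ⟨g, hg, rfl⟩ := List.mem_map.1 hu
      have h8 := hΓS g hg
      rw [show E.S = boxR 0 (7 * n) 0 (8 * n - 1) from rfl, mem_boxR_iff] at h8
      rw [hτ, planarReflect_apply]
      simp only
      omega
    · simp only; omega
  have hTBbox : ∀ v ∈ TB, v ∈ boxR (-1) (14 * n + 1) (-1) (13 * n - 1) := by
    intro v hv
    rw [mem_boxR_iff]
    rw [hTB, List.mem_append, List.mem_append, mem_colWalk_iff, List.mem_singleton] at hv
    rcases hv with ⟨h1, h2, h3⟩ | hv | rfl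
    · omega
    · have := hmemπ v hv; omega
    · simp only; omega
  -- endpoints
  have hLRhead : (LR.head hLRne).1 = -1 := by simp [hLR]
  have hLRlast' : LR.getLast hLRne = (14 * (n : ℤ) + 1, a₂) := by
    have e : LR = ((-1, a₂) :: (pγ ++ (pγ.map τ).reverse)) ++ [(14 * (n : ℤ) + 1, a₂)] := by simp [hLR]
    rw [List.getLast_congr hLRne (by simp) e, List.getLast_append_of_ne_nil _ (List.cons_ne_nil _ _),
      List.getLast_singleton]
  have hLRlast : (LR.getLast hLRne).1 = 14 * n + 1 := by rw [hLRlast']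
  have hTBhead' : TB.head hTBne = (-1, c₂ + m) := by
    apply Option.some.inj
    rw [← List.head?_eq_some_head hTBne, hTB, List.head?_append, head?_colWalk, Option.some_or]
  have hTBhead : (TB.head hTBne).2 = 13 * n - 1 := by rw [hTBhead']; exact hmc
  have hTBlast' : TB.getLast hTBne = ((planar k z).1, -1) := by
    apply Option.some.inj
    rw [← List.getLast?_eq_some_getLast hTBne]
    simp [hTB]
  have hTBlast : (TB.getLast hTBne).2 = -1 := by rw [hTBlast']
  -- the crossing
  obtain ⟨v, hvLR, hvTB⟩ := planarCrossing_rect' (a := -1) (b := 14 * (n : ℤ) + 1) (c := -1)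
    (d := 13 * (n : ℤ) - 1) (A := {v | v.1 = -1}) (B := {v | v.1 = 14 * (n : ℤ) + 1})
    (C := {v | v.2 = 13 * (n : ℤ) - 1}) (D := {v | v.2 = -1}) (fun _ h => h) (fun _ h => h) (fun _ h => h)
    (fun _ h => h) LR TB hLRne hTBne hwLR hwTB hLRbox hTBbox hLRhead hLRlast hTBhead hTBlast
  -- case analysis: the meeting cell lies on `pπ` and on `τ pγ`
  rw [hTB, List.mem_append, List.mem_append, mem_colWalk_iff, List.mem_singleton] at hvTB
  rw [hLR, List.mem_cons, List.mem_append, List.mem_append, List.mem_reverse, List.mem_singleton] at hvLR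
  have hvπ : v ∈ pπ ∧ v ∈ pγ.map τ := by
    rcases hvTB with ⟨h1, h2, h3⟩ | hvπ | rfl
    · -- on the column `x = -1`: only the left stub has `x = -1`, but it is lower
      exfalso
      rcases hvLR with rfl | hv | hv | rfl
      · simp only at h2; omega
      · have := hmemγ v hv; omega
      · obtain ⟨u, hu, rfl⟩ := List.mem_map.1 hv
        have := hmemγ u hu
        rw [hτ, planarReflect_apply] at h1
        simp only at h1
        omega
      · simp only at h1; omega
    · refine ⟨hvπ, ?_⟩
      have hb := hmemπ v hvπ
      rcases hvLR with rfl | hv | hv | rfl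
      · exfalso; simp only at hb; omega
      · -- on `Γ̄`: excluded, the path avoids `𝒩(Γ, ρ₂) ⊇ Γ̄`
        exfalso
        obtain ⟨u, hu, hvu⟩ := List.mem_map.1 hvπ
        obtain ⟨g, hg, hvg⟩ := List.mem_map.1 hv
        refine (hπR u hu).2 ⟨g, hg, ?_⟩
        rw [hvu, ← hvg]
        exact mem_sqBox_self _ _
      · exact hv
      · exfalso; simp only at hb; omega
    · exfalso
      rcases hvLR with h | hv | hv | h
      · simp only [Prod.mk.injEq] at h; omega
      · have := hmemγ _ hv; simp only at this; omega
      · obtain ⟨u, hu, hu'⟩ := List.mem_map.1 hv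
        have := hmemγ u hu
        rw [hτ, planarReflect_apply, Prod.mk.injEq] at hu'
        omega
      · simp only [Prod.mk.injEq] at h; omega
  obtain ⟨hvπ, hvτ⟩ := hvπ
  obtain ⟨u, hu, hvu⟩ := List.mem_map.1 hvπ
  obtain ⟨g', hg', hvg'⟩ := List.mem_map.1 hvτ
  obtain ⟨g, hg, rfl⟩ := List.mem_map.1 hg'
  -- the initial segment of `π` up to `u`
  obtain ⟨p, s, hps⟩ := List.append_of_mem hu
  have hsub : ∀ x ∈ p ++ [u], x ∈ slabLift k (E.R \ {z | Near k Γ ρ₂ z}) := by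
    intro x hx
    have hxπ : x ∈ π := by
      rw [hps]
      rcases List.mem_append.1 hx with hx | hx
      · exact List.mem_append_left _ hx
      · rw [List.mem_singleton] at hx; subst hx; simp
    exact hπR x hxπ
  have hchain : (p ++ [u]).IsChain (fun a b => s(a, b) ∈ ω' ∧ a ≠ b) := by
    have hc := hπ.chain
    rw [hps, ← List.singleton_append, ← List.append_assoc] at hc
    exact (List.isChain_append.1 hc).1
  obtain ⟨a, l, hal⟩ := List.exists_cons_of_ne_nil (show p ++ [u] ≠ [] by simp)
  have hac : a = c := by
    have h1 : π.head hπ.ne_nil = a := by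
      have : π = (a :: l) ++ s := by rw [hps, ← hal]; simp
      rw [List.head_eq_iff_head?_eq_some, this]; simp
    rw [← hπhead, h1]
  have hlast : (a :: l).getLast (List.cons_ne_nil a l) = u := by
    rw [List.getLast_congr _ (by simp) hal.symm]; simp
  have hconn : ω' ∈ openConnIn (slabLift k (E.R \ {z | Near k Γ ρ₂ z})) c u := by
    rw [← hac, ← hlast]
    rw [hal] at hchain hsub
    exact openConnIn_of_isChain a l hchain hsub
  refine ⟨c, hc, u, ?_, hconn⟩
  show planar k u ∈ {z | ∃ g ∈ Γ, z = τ (planar k g)}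
  exact ⟨g, hg, by rw [hvu, ← hvg']⟩

/-- **Measure form**: for an admissible `ω` (lattice, `A ⟷^{S'} B`),
`P[C ⟷^{R' ∖ 𝒞(ω)} 𝖡] ≤ P[C ⟷^{R' ∖ 𝒩(Γ,ρ₂)} τΓ]` with `𝒞 = Q.explored`.
[cite: NewmanTassionWu2017, §3.5 (proof of Theorem 3.14, Case 3, (3.49): "P[Y ⟷^{R∖C} 𝖡(R)] ≤ P[𝒞_γ]")] -/
theorem real_evOff_explored_le_toMirror (hω : ω ⊆ (slabGraph 3 k).edgeSet)
    (hA : ω ∈ (case2Setup n hn).Q.evAB k) (p : unitInterval) :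
    (bondPercolation (slabGraph 3 k) p).real
        ((case2Setup n hn).Q.evOff k {z | z.2 = 0} ((case2Setup n hn).Q.explored k ρ₂ ω)) ≤
      (bondPercolation (slabGraph 3 k) p).real
        (slabConn k ((case2Setup n hn).R \ {z | Near k ((case2Setup n hn).Q.γ k ω) ρ₂ z}) (case2Setup n hn).C
          {z | ∃ g ∈ (case2Setup n hn).Q.γ k ω, z = planarReflect (14 * (n : ℤ)) (planar k g)}) := by
  set P := bondPercolation (slabGraph 3 k) p with hP
  have hK : ∀ v ∈ slabLift k (case2Setup n hn).R, Near k ((case2Setup n hn).Q.γ k ω) ρ₂ (planar k v) →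
      v ∈ (case2Setup n hn).Q.explored k ρ₂ ω :=
    fun v hv hnear => GlueData.mem_explored_of_isSeed (Or.inr hnear) hv
  have hae : ∀ᵐ ω' ∂P, ω' ∈ (case2Setup n hn).Q.evOff k {z | z.2 = 0} ((case2Setup n hn).Q.explored k ρ₂ ω) →
      ω' ∈ slabConn k ((case2Setup n hn).R \ {z | Near k ((case2Setup n hn).Q.γ k ω) ρ₂ z}) (case2Setup n hn).C
          {z | ∃ g ∈ (case2Setup n hn).Q.γ k ω, z = planarReflect (14 * (n : ℤ)) (planar k g)} := by
    filter_upwards [ae_subset_edgeSet (slabGraph 3 k) p] with ω' hω' h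
    exact evOff_subset_toMirror hn hω hA hK hω' h
  simp only [measureReal_def]
  exact ENNReal.toReal_mono (measure_ne_top _ _) (measure_mono_ae hae)

end Sep

end NTW17

end Literature.Probability.Percolation
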